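import Mathlib
import Summits.ValiantsHypothesis.ValiantsHypothesis.Theorems.FifoMatchingNNNotVPSupportFnHardOfCore
import Summits.ValiantsHypothesis.ValiantsHypothesis.Theorems.FifoMatchingNNNotVPSupportFnCircuitLowerBound
import Summits.ValiantsHypothesis.ValiantsHypothesis.Theorems.FifoMatchingNNNotVPNfpmExpLowerBound
import HarnessLib

/-!
# Route FifoMatching — crux `NNNotVP` (stmt-ValiantsHypothesis-11615), line `division_split`:
# the EXPONENTIAL form of stub A (`stub_supportFnHard`)

Registered line `Cruxes/NNNotVP/Lines/division_split.lean`; objects `σ` / `NN` / `SuppFn` /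
`freeVars` = the line's vocabulary (`Theorems/FifoMatchingNNNotVPDivisionSplitDefs.lean`).

Stub A of the line (✓ p821759) says: for all `k, c`, eventually every `g ∈ ℝ≥0[x]` with the support
function of `NN_n` with `≤ (log₂ n + k)^k` freed arcs has `L₊(g) > 2^((log₂ n + c)^c)` — a
QUASI-POLYNOMIAL rate, although the engine behind it (Alon–Boppana for `⌊√m⌋`-cliques) is
exponential.  This file runs the landed chain «Boolean lower bound ⟹ core ⟹ stub A»
(`core_of_circuitSizeOver_lowerBound`, `supportFnHard_of_core`) at EXPONENTIAL rate, in the integer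
form `n ≤ (log₂ cost)^r`:

* `eventually_polylog_lt` — `(2 log₂ n + k)^r < n` eventually;
* `coreExp_of_circuitSizeOver_expLowerBound` — an exponential bound on
  `circuitSizeOver monotoneBasis` of NFPM existence gives: eventually every `g` with the support
  function of `NN_n` has `n ≤ (log₂ L₊(g))^r` (Boolean shadow, `+ 8n²` gates absorbed);
* `supportFnExpHard_of_coreExp` — the core at exponential rate gives the freed-arc version at
  exponential rate (interval carving to `m ≥ 2^(⌊log₂ n⌋/2)`, `n < (m+1)²`, rate `r ↦ 2r+2`);
* ★ `supportFnExpHard` — **stub A at exponential rate**: for every `k` there are `r, n₀` with: for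
  `n ≥ n₀`, every `T` of `≤ (log₂ n + k)^k` arcs and every `g ∈ ℝ≥0[x]` with the support function of
  `NN_n|_{T := 1}`, `n ≤ (log₂ L₊(g))^r` (i.e. `L₊(g) ≥ 2^{n^{1/r}}`), from the tree's
  `nfpmExists_monotone_circuitSize_expLowerBound'`.

Honest framing: a sharpening (qp ↦ exp) of a landed stub, used by the companion
`…SpreadCofactorIffExpHard` to classify stub B2; stubs Z / B2, the crux `NNNotVP` and `VP ≠ VNP`
stay OPEN (NOT proved).  No definitions, no named facts.
-/

noncomputable section

-- Sub = Summit single-conjunct layout: the duplicated namespace component is mandated by the tree.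
set_option linter.dupNamespace false

namespace Summit.ValiantsHypothesis.ValiantsHypothesis.Theorems.FifoMatching.NNNotVP.DivisionSplit

open MvPolynomial Finset Literature.Computability.AlgebraicComplexity
open Literature.Computability.Complexity
open Literature.Computability.Complexity.GateList
open Summit.ValiantsHypothesis.ValiantsHypothesis.Theorems.FifoMatching.NNLowDegreeCofactorHard.FreedVertices
open scoped NNReal BigOperators Classical

/-! ### Arithmetic: a polylog is eventually below `n` -/

/-- `(2 log₂ n + k)^r < n` for all large `n`. [folklore] -/
theorem eventually_polylog_lt (k r : ℕ) :
    ∃ n₀ : ℕ, ∀ n ≥ n₀, (2 * Nat.log 2 n + k) ^ r < n := by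
  obtain ⟨h₀, hh₀⟩ := CorSandwich.polylog_lt_rpow_eventually (k + 2 * r + 2) (c := 1) one_pos
  refine ⟨max h₀ 1, fun n hn => ?_⟩
  have hn0 : h₀ ≤ n := le_trans (le_max_left _ _) hn
  have hreal := hh₀ n hn0
  rw [Real.rpow_one] at hreal
  have hnat : (Nat.log 2 n + (k + 2 * r + 2)) ^ (k + 2 * r + 2) < n := by exact_mod_cast hreal
  calc (2 * Nat.log 2 n + k) ^ r ≤ (2 * (Nat.log 2 n + (k + 2 * r + 2))) ^ r :=
        Nat.pow_le_pow_left (by omega) r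
    _ = 2 ^ r * (Nat.log 2 n + (k + 2 * r + 2)) ^ r := by rw [mul_pow]
    _ ≤ (Nat.log 2 n + (k + 2 * r + 2)) ^ r * (Nat.log 2 n + (k + 2 * r + 2)) ^ r :=
        Nat.mul_le_mul_right _ (Nat.pow_le_pow_left (by omega) r)
    _ = (Nat.log 2 n + (k + 2 * r + 2)) ^ (2 * r) := by rw [← pow_add]; ring_nf
    _ ≤ (Nat.log 2 n + (k + 2 * r + 2)) ^ (k + 2 * r + 2) :=
        Nat.pow_le_pow_right (by omega) (by omega)
    _ < n := hnat

/-! ### The core at exponential rate from the Boolean bound -/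

/-- **An exponential bound on `circuitSizeOver monotoneBasis` gives the core of stub A at
exponential rate.**  If eventually `n ≤ (log₂ s_n)^r` for `s_n` the monotone circuit size of NFPM
existence on `[2n]`, then eventually every `g ∈ ℝ≥0[x]` with the support function of `NN_n` has
`n ≤ (log₂ L₊(g))^(2r)`: its Boolean shadow over `monotoneBasis` has `≤ L₊(g) + 8n²` gates
(`exists_monotoneCircuit_eval_ne_zero_pure`); if `L₊(g) ≤ 8n²` this makes `n` polylogarithmic in `n`
(absurd eventually), otherwise `log₂ (L₊(g) + 8n²) ≤ log₂ L₊(g) + 1 ≤ (log₂ L₊(g))²`. [folklore] -/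
theorem coreExp_of_circuitSizeOver_expLowerBound
    (hB : ∃ r n₀ : ℕ, ∀ n ≥ n₀, n ≤ (Nat.log 2 (circuitSizeOver monotoneBasis
      (fun x : σ n → Bool => decide (SuppFn (NN n) (Finset.univ.filter fun e => x e = true))))) ^ r) :
    ∃ r n₀ : ℕ, ∀ n ≥ n₀, ∀ g : MvPolynomial (σ n) ℝ≥0,
      (∀ A : Finset (σ n), SuppFn g A ↔ SuppFn (NN n) A) → n ≤ (Nat.log 2 (complexity g)) ^ r := by
  obtain ⟨r, n₀, hn₀⟩ := hB
  obtain ⟨n₁, hn₁⟩ := eventually_polylog_lt 5 r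
  refine ⟨2 * r, max (max n₀ n₁) 2, fun n hn g hg => ?_⟩
  have hnn₀ : n₀ ≤ n := le_trans (le_max_left _ _) (le_trans (le_max_left _ _) hn)
  have hnn₁ : n₁ ≤ n := le_trans (le_max_right _ _) (le_trans (le_max_left _ _) hn)
  have hn2 : 2 ≤ n := le_trans (le_max_right _ _) hn
  obtain ⟨hU, hE⟩ := suppFn_NN_univ_and_empty n (by omega)
  -- the support function of `g` is not constant
  have h1 : eval (fun _ => (1 : ℝ≥0)) g ≠ 0 := by
    have h := (suppFn_iff_eval_ne_zero g Finset.univ).1 ((hg _).2 hU)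
    simpa using h
  have h0 : eval (fun _ => (0 : ℝ≥0)) g = 0 := by
    by_contra h
    apply hE
    rw [← hg]
    rw [suppFn_iff_eval_ne_zero]
    simpa using h
  obtain ⟨C, hC1, hC2, hC3⟩ := exists_monotoneCircuit_eval_ne_zero_pure g h1 h0
  have hcomp : C.Computes
      (fun x : σ n → Bool => decide (SuppFn (NN n) (Finset.univ.filter fun e => x e = true))) := by
    intro x
    rw [hC3 x]
    apply decide_eq_decide.2
    rw [← hg, suppFn_iff_eval_ne_zero]
    simp [Finset.mem_filter]
  have hsize := circuitSizeOver_le_of_computes C hC1 hcomp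
  have hcard : Fintype.card (σ n) = 2 * n * (2 * n) := by
    simp [σ, Fintype.card_prod, Fintype.card_fin]
  set S : ℕ := circuitSizeOver monotoneBasis
      (fun x : σ n → Bool => decide (SuppFn (NN n) (Finset.univ.filter fun e => x e = true))) with hS
  set x : ℕ := complexity g with hx
  have hSx : S ≤ x + 8 * n ^ 2 := by
    have := hsize.trans hC2
    rw [hcard] at this
    calc S ≤ x + 2 * (2 * n * (2 * n)) := this
      _ = x + 8 * n ^ 2 := by ring
  have hmain : n ≤ (Nat.log 2 S) ^ r := hn₀ n hnn₀
  have hlogS : Nat.log 2 S ≤ Nat.log 2 (x + 8 * n ^ 2) := Nat.log_mono_right hSx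
  -- `n² < 2^(2L+2)` with `L = ⌊log₂ n⌋`
  have hnL : n < 2 ^ (Nat.log 2 n + 1) := Nat.lt_pow_succ_log_self (by norm_num) n
  have hn2L : n ^ 2 < 2 ^ (2 * Nat.log 2 n + 2) := by
    have h' : n * n < 2 ^ (Nat.log 2 n + 1) * 2 ^ (Nat.log 2 n + 1) :=
      Nat.mul_lt_mul_of_lt_of_le' hnL hnL.le (by omega)
    rw [← pow_add] at h'
    calc n ^ 2 = n * n := sq n
      _ < 2 ^ (Nat.log 2 n + 1 + (Nat.log 2 n + 1)) := h'
      _ = 2 ^ (2 * Nat.log 2 n + 2) := by ring_nf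
  by_cases hsmall : x ≤ 8 * n ^ 2
  · -- `L₊(g) ≤ 8n²`: then `n ≤ (2L+5)^r < n`
    exfalso
    have hlt : x + 8 * n ^ 2 < 2 ^ (2 * Nat.log 2 n + 6) := by
      have : 2 ^ (2 * Nat.log 2 n + 6) = 16 * 2 ^ (2 * Nat.log 2 n + 2) := by
        rw [show 2 * Nat.log 2 n + 6 = (2 * Nat.log 2 n + 2) + 4 by ring, pow_add]; ring
      rw [this]; omega
    have hlog : Nat.log 2 (x + 8 * n ^ 2) < 2 * Nat.log 2 n + 6 :=
      Nat.log_lt_of_lt_pow (by positivity) hlt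
    have h5 : n ≤ (2 * Nat.log 2 n + 5) ^ r :=
      calc n ≤ (Nat.log 2 S) ^ r := hmain
        _ ≤ (Nat.log 2 (x + 8 * n ^ 2)) ^ r := Nat.pow_le_pow_left hlogS r
        _ ≤ (2 * Nat.log 2 n + 5) ^ r := Nat.pow_le_pow_left (by omega) r
    exact absurd (hn₁ n hnn₁) (not_lt.2 h5)
  · -- `L₊(g) > 8n²`: then `log₂ (x + 8n²) ≤ log₂ x + 1 ≤ (log₂ x)²`
    push Not at hsmall
    have hx32 : 32 ≤ x := by nlinarith
    have hℓ5 : 5 ≤ Nat.log 2 x := Nat.le_log_of_pow_le (by norm_num) (by norm_num; omega)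
    have hxlt : x < 2 ^ (Nat.log 2 x + 1) := Nat.lt_pow_succ_log_self (by norm_num) x
    have hlt : x + 8 * n ^ 2 < 2 ^ (Nat.log 2 x + 2) := by
      have h22 : 2 ^ (Nat.log 2 x + 2) = 2 ^ (Nat.log 2 x + 1) * 2 := pow_succ _ _
      rw [h22]; omega
    have hlog : Nat.log 2 (x + 8 * n ^ 2) < Nat.log 2 x + 2 :=
      Nat.log_lt_of_lt_pow (by positivity) hlt
    have hsq : Nat.log 2 x + 1 ≤ (Nat.log 2 x) ^ 2 := by nlinarith
    calc n ≤ (Nat.log 2 S) ^ r := hmain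
      _ ≤ (Nat.log 2 (x + 8 * n ^ 2)) ^ r := Nat.pow_le_pow_left hlogS r
      _ ≤ (Nat.log 2 x + 1) ^ r := Nat.pow_le_pow_left (by omega) r
      _ ≤ ((Nat.log 2 x) ^ 2) ^ r := Nat.pow_le_pow_left hsq r
      _ = (Nat.log 2 x) ^ (2 * r) := by rw [← pow_mul]

/-! ### The freed-arc version at exponential rate (interval carving) -/

/-- **The core at exponential rate gives stub A at exponential rate.**  Given `k`, run the core
(rate `r`, threshold `n₁`); for `n` large, `T` with `|T| ≤ (log₂ n + k)^k` and `g` with the support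
function of `NN_n|_{T := 1}`: the endpoints `R` of `T` miss an even-aligned block of half-length
`m = n/(|R|+1) ≥ 2^(⌊log₂ n⌋/2) ≥ n₁` with `n < (m+1)²`; carving `g` along it gives `g'` with the
support function of `NN_m` and `L₊(g') ≤ L₊(g)`, so `m ≤ (log₂ L₊(g))^r =: ℓ^r`, `ℓ ≥ 2`, and
`n < (ℓ^r + 1)² ≤ ℓ^(2r+2)`. [folklore] -/
theorem supportFnExpHard_of_coreExp
    (hA₀ : ∃ r n₀ : ℕ, ∀ n ≥ n₀, ∀ g : MvPolynomial (σ n) ℝ≥0,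
      (∀ A : Finset (σ n), SuppFn g A ↔ SuppFn (NN n) A) → n ≤ (Nat.log 2 (complexity g)) ^ r) :
    ∀ k : ℕ, ∃ r n₀ : ℕ, ∀ n ≥ n₀, ∀ T : Finset (σ n), T.card ≤ (Nat.log 2 n + k) ^ k →
      ∀ g : MvPolynomial (σ n) ℝ≥0,
        (∀ A : Finset (σ n), SuppFn g A ↔ SuppFn (freeVars T (NN n)) A) →
          n ≤ (Nat.log 2 (complexity g)) ^ r := by
  intro k
  obtain ⟨r, n₁, hn₁⟩ := hA₀
  obtain ⟨n₂, hn₂⟩ := eventually_sq_polylog_le k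
  refine ⟨2 * r + 2, max n₂ (2 ^ (2 * (Nat.log 2 n₁ + 1) + 2)), fun n hn T hT g hg => ?_⟩
  have hn2 : n₂ ≤ n := le_trans (le_max_left _ _) hn
  have hnL : 2 ^ (2 * (Nat.log 2 n₁ + 1) + 2) ≤ n := le_trans (le_max_right _ _) hn
  have hnpos : 0 < n := lt_of_lt_of_le (Nat.two_pow_pos _) hnL
  -- the freed vertices
  obtain ⟨R, hRT⟩ : ∃ R : Finset (Fin (2 * n)), R = T.biUnion (fun e => {e.1, e.2}) := ⟨_, rfl⟩
  have hRcard : R.card ≤ 2 * (Nat.log 2 n + k) ^ k := by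
    rw [hRT]
    calc (T.biUnion (fun e => {e.1, e.2})).card ≤ ∑ e ∈ T, ({e.1, e.2} : Finset (Fin (2 * n))).card :=
          card_biUnion_le
      _ ≤ ∑ e ∈ T, 2 := sum_le_sum fun e _ => card_le_two
      _ = 2 * T.card := by rw [sum_const, smul_eq_mul, mul_comm]
      _ ≤ 2 * (Nat.log 2 n + k) ^ k := Nat.mul_le_mul_left 2 hT
  have hmemR : ∀ e ∈ T, e.1 ∈ R ∧ e.2 ∈ R := fun e he => by
    rw [hRT]
    exact ⟨mem_biUnion.2 ⟨e, he, by simp⟩, mem_biUnion.2 ⟨e, he, by simp⟩⟩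
  -- the block half-length `m = n / (|R|+1)`
  obtain ⟨m, hm_eq⟩ : ∃ m, m = n / (R.card + 1) := ⟨_, rfl⟩
  have hsq : (R.card + 1) * (R.card + 1) ≤ n := by
    refine le_trans (Nat.mul_le_mul ?_ ?_) (hn₂ n hn2) <;> omega
  have hRm : R.card + 1 ≤ m := by
    rw [hm_eq]
    exact (Nat.le_div_iff_mul_le (Nat.succ_pos _)).2 hsq
  have hmpos : 0 < m := by omega
  have hlt : n < (R.card + 1) * (m + 1) := by
    rw [hm_eq]
    exact Nat.lt_mul_div_succ n (Nat.succ_pos R.card)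
  have hnm : n < (m + 1) * (m + 1) :=
    lt_of_lt_of_le hlt (Nat.mul_le_mul_right _ (by omega))
  -- `2^(⌊log₂ n⌋/2) ≤ m`
  have h2L : 2 ^ Nat.log 2 n ≤ n := Nat.pow_log_le_self 2 (by omega)
  have hmL : 2 ^ (Nat.log 2 n / 2) ≤ m := by
    by_contra hcon
    push Not at hcon
    have h1 : m + 1 ≤ 2 ^ (Nat.log 2 n / 2) := hcon
    have h2 : (m + 1) * (m + 1) ≤ 2 ^ (Nat.log 2 n / 2) * 2 ^ (Nat.log 2 n / 2) :=
      Nat.mul_le_mul h1 h1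
    have h3 : 2 ^ (Nat.log 2 n / 2) * 2 ^ (Nat.log 2 n / 2) ≤ 2 ^ Nat.log 2 n := by
      rw [← pow_add]
      exact Nat.pow_le_pow_right (by norm_num) (by omega)
    omega
  have hLge : 2 * (Nat.log 2 n₁ + 1) + 2 ≤ Nat.log 2 n := Nat.le_log_of_pow_le (by norm_num) hnL
  have hm1 : n₁ ≤ m := by
    have h1 : 2 ^ (Nat.log 2 n₁ + 1) ≤ 2 ^ (Nat.log 2 n / 2) :=
      Nat.pow_le_pow_right (by norm_num) (by omega)
    have h2 : n₁ < 2 ^ (Nat.log 2 n₁ + 1) := Nat.lt_pow_succ_log_self (by norm_num) n₁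
    omega
  have hm2 : 2 ≤ m := by
    have h1 : 2 ^ 1 ≤ 2 ^ (Nat.log 2 n / 2) := Nat.pow_le_pow_right (by norm_num) (by omega)
    omega
  -- the carving block, missing `R`
  obtain ⟨j, hj, hfree⟩ := Carve.exists_free_block R hmpos
  have hmn : (R.card + 1) * m ≤ n := by
    rw [hm_eq]
    exact Nat.mul_div_le n (R.card + 1)
  have hmj : m * j + m ≤ n :=
    calc m * j + m ≤ m * R.card + m := Nat.add_le_add_right (Nat.mul_le_mul_left m hj) m
      _ = (R.card + 1) * m := by ring
      _ ≤ n := hmn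
  have hle : 2 * m * j + 2 * m ≤ 2 * n :=
    calc 2 * m * j + 2 * m = 2 * (m * j + m) := by ring
      _ ≤ 2 * n := by omega
  have heven : (2 * m * j) % 2 = 0 := by
    rw [Nat.mul_assoc]
    exact Nat.mul_mod_right 2 _
  let Cv : Carve.Carving n := ⟨2 * m * j, m, hle, hmpos, heven⟩
  have hRI : ∀ i ∈ Cv.I, i ∉ R := fun i hi hiR => hfree i hiR (Cv.mem_I.1 hi)
  have hTout : ∀ e ∈ T, e.1 ∉ Cv.I ∧ e.2 ∉ Cv.I := fun e he =>
    ⟨fun h => hRI _ h (hmemR e he).1, fun h => hRI _ h (hmemR e he).2⟩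
  -- the pulled-back arc sets contain `T`
  have hB : ∀ A' : Finset (σ Cv.m), ∃ B : Finset (σ n),
      (∀ p : MvPolynomial (σ n) ℝ≥0, SuppFn (aeval Cv.subst p) A' ↔ SuppFn p B) ∧ T ⊆ B :=
    fun A' => ⟨_, fun p => suppFn_carve_iff Cv p A',
      fun e he => mem_filter.2 ⟨mem_univ _, Or.inr (hTout e he)⟩⟩
  -- the carved polynomial has the support function of `NN_m`
  have hg' : ∀ A' : Finset (σ Cv.m),
      SuppFn (aeval Cv.subst g) A' ↔ SuppFn (NN Cv.m) A' := by
    intro A'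
    obtain ⟨B, hBiff, hTB⟩ := hB A'
    rw [hBiff g, hg B, suppFn_freeVars_iff_of_subset hTB, ← hBiff (NN n),
      suppFn_iff_of_support_eq (support_aeval_subst_NN Cv) A']
  -- the core at `m`, and the rate
  have hcore : m ≤ (Nat.log 2 (complexity (aeval Cv.subst g))) ^ r :=
    hn₁ m hm1 (aeval Cv.subst g) hg'
  set ℓ : ℕ := Nat.log 2 (complexity g) with hℓ
  have hmℓ : m ≤ ℓ ^ r :=
    hcore.trans (Nat.pow_le_pow_left (Nat.log_mono_right (complexity_carve_le Cv g)) r)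
  have hℓ2 : 2 ≤ ℓ := by
    by_contra hcon
    push Not at hcon
    have : ℓ ^ r ≤ 1 ^ r := Nat.pow_le_pow_left (by omega) r
    rw [one_pow] at this
    omega
  have hsucc : ℓ ^ r + 1 ≤ ℓ ^ (r + 1) := by
    have h1 : 1 ≤ ℓ ^ r := Nat.one_le_pow _ _ (by omega)
    rw [pow_succ]
    nlinarith
  calc n ≤ (m + 1) * (m + 1) := hnm.le
    _ ≤ (ℓ ^ r + 1) * (ℓ ^ r + 1) := Nat.mul_le_mul (by omega) (by omega)
    _ ≤ ℓ ^ (r + 1) * ℓ ^ (r + 1) := Nat.mul_le_mul hsucc hsucc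
    _ = ℓ ^ (2 * r + 2) := by rw [← pow_add]; ring_nf

/-- ★ **Stub A at EXPONENTIAL rate.**  For every `k` there are `r, n₀` such that for all `n ≥ n₀`,
every `T` of `≤ (log₂ n + k)^k` arcs and every `g ∈ ℝ≥0[x]` with the support function of
`NN_n|_{T := 1}` satisfy `n ≤ (log₂ L₊(g))^r`, i.e. `L₊(g) ≥ 2^{n^{1/r}}`
(`supportFnExpHard_of_coreExp` ∘ `coreExp_of_circuitSizeOver_expLowerBound` at the tree's
`nfpmExists_monotone_circuitSize_expLowerBound'`; one may take `r = 834`). [folklore] -/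
theorem supportFnExpHard :
    ∀ k : ℕ, ∃ r n₀ : ℕ, ∀ n ≥ n₀, ∀ T : Finset (σ n), T.card ≤ (Nat.log 2 n + k) ^ k →
      ∀ g : MvPolynomial (σ n) ℝ≥0,
        (∀ A : Finset (σ n), SuppFn g A ↔ SuppFn (freeVars T (NN n)) A) →
          n ≤ (Nat.log 2 (complexity g)) ^ r :=
  supportFnExpHard_of_coreExp
    (coreExp_of_circuitSizeOver_expLowerBound nfpmExists_monotone_circuitSize_expLowerBound')

end Summit.ValiantsHypothesis.ValiantsHypothesis.Theorems.FifoMatching.NNNotVP.DivisionSplit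

end
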